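import Summits.CriticalPhenomena.PercolationContinuityZ3.Theorems.PercNearOneGluingNoHeavyLowerTailAPLProfileAll
import HarnessLib

/-!
# `NoHeavyLowerTail` (stmt-CriticalPhenomena-4575) — APL(2/3) for every finite weighted graph, event form

Support file (prover prim-ineq-gen-8 gen 37; `--supports stmt-CriticalPhenomena-4575`; memo
run/shared/lean/prim/prim-ineq-gen-8/FINDING-gen37-APL-PROOF.md).  No definitions, no named facts, no sorries.

The quotable form of `APL.apl23_all`: for `μ = prodBernoulli w` on the pairs of any finite vertex type and any vertices `a, b, c`,
  **`2 · μ(b ↮ c) · μ(a ↔ b ∨ a ↔ c) ≤ 3 · (μ(a ↔ b, a ↮ c) + μ(a ↔ c, a ↮ b))`**,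
i.e. for the increasing event `A = {a ↔ {b,c}}` and the decreasing event `B = {b ↮ c}` (whose intersection is "`a` is joined to exactly one
of `b, c`"):  `P(A ∩ B) ≥ (2/3)·P(A)·P(B)` — a reverse Harris inequality with the sharp constant `2/3` (deep symmetric hub trees, prove-5
g35).  Conjectured by the APL lane (prim-ineq-gen-8 g8/g9, prim-ineq-prove-5 g35–g38, prim-cert-1 g11–g16); previously known for
`G − {b,c}` a forest (gen 36 `apl23_forest`), for `≤ 9` vertices (prim-cert-1 census) and with an `n`-dependent constant (`apl_nonuniform`).
* `real_notConn_bc_eq_cells`, `real_conn_ab_or_ac_eq_cells` — `μ(b↮c) = u0 + uab + uac`, `μ(a↔b ∨ a↔c) = uab + uac + u3`;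
* **`apl_twoThirds_all`** — the displayed inequality. [this work]
-/

noncomputable section

namespace Summit.CriticalPhenomena.PercolationContinuityZ3.Theorems

namespace APL

open MeasureTheory Set Literature.Probability.Percolation Literature.Probability.LatticeModels
open scoped Classical

variable {V : Type*} [Fintype V]

/-- `μ(b ↮ c) = μ(a|b|c) + μ(ab|c) + μ(ac|b)`. [folklore] -/
theorem real_notConn_bc_eq_cells (w : Sym2 V → unitInterval) (a b c : V) :
    (prodBernoulli w).real ((openConn b c : Set (BondConfig V))ᶜ) =
      (prodBernoulli w).real ((openConn a b)ᶜ ∩ (openConn a c)ᶜ ∩ (openConn b c)ᶜ : Set (BondConfig V))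
        + (prodBernoulli w).real (openConn a b ∩ (openConn a c)ᶜ : Set (BondConfig V))
        + (prodBernoulli w).real (openConn a c ∩ (openConn a b)ᶜ : Set (BondConfig V)) := by
  have h1 := ClusterCovTransfer.real_eq_inter_add_inter_compl w ((openConn b c : Set (BondConfig V))ᶜ) (openConn a b : Set (BondConfig V))
  have h2 := ClusterCovTransfer.real_eq_inter_add_inter_compl w
    ((openConn b c : Set (BondConfig V))ᶜ ∩ (openConn a b : Set (BondConfig V))ᶜ) (openConn a c : Set (BondConfig V))
  have e1 : (openConn b c : Set (BondConfig V))ᶜ ∩ (openConn a b : Set (BondConfig V)) = (openConn a b ∩ (openConn a c)ᶜ : Set (BondConfig V)) := by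
    ext ω
    simp only [mem_inter_iff, mem_compl_iff]
    constructor
    · rintro ⟨hbc, hab⟩
      exact ⟨hab, fun hac => hbc (SimpleGraph.Reachable.trans (SimpleGraph.Reachable.symm hab) hac)⟩
    · rintro ⟨hab, hac⟩
      exact ⟨fun hbc => hac (SimpleGraph.Reachable.trans hab hbc), hab⟩
  have e2 : (openConn b c : Set (BondConfig V))ᶜ ∩ (openConn a b : Set (BondConfig V))ᶜ ∩ (openConn a c : Set (BondConfig V)) =
      (openConn a c ∩ (openConn a b)ᶜ : Set (BondConfig V)) := by
    ext ω
    simp only [mem_inter_iff, mem_compl_iff]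
    constructor
    · rintro ⟨⟨_, hab⟩, hac⟩; exact ⟨hac, hab⟩
    · rintro ⟨hac, hab⟩
      exact ⟨⟨fun hbc => hab (SimpleGraph.Reachable.trans hac (SimpleGraph.Reachable.symm hbc)), hab⟩, hac⟩
  have e3 : (openConn b c : Set (BondConfig V))ᶜ ∩ (openConn a b : Set (BondConfig V))ᶜ ∩ (openConn a c : Set (BondConfig V))ᶜ =
      ((openConn a b)ᶜ ∩ (openConn a c)ᶜ ∩ (openConn b c)ᶜ : Set (BondConfig V)) := by
    ext ω; simp only [mem_inter_iff, mem_compl_iff]; tauto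
  rw [e1] at h1
  rw [e2, e3] at h2
  linarith

/-- `μ(a↔b ∨ a↔c) = μ(ab|c) + μ(ac|b) + μ(a↔b, a↔c)`. [folklore] -/
theorem real_conn_ab_or_ac_eq_cells (w : Sym2 V → unitInterval) (a b c : V) :
    (prodBernoulli w).real (openConn a b ∪ openConn a c : Set (BondConfig V)) =
      (prodBernoulli w).real (openConn a b ∩ (openConn a c)ᶜ : Set (BondConfig V))
        + (prodBernoulli w).real (openConn a c ∩ (openConn a b)ᶜ : Set (BondConfig V))
        + (prodBernoulli w).real (openConn a b ∩ openConn a c : Set (BondConfig V)) := by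
  have h1 := ClusterCovTransfer.real_eq_inter_add_inter_compl w (openConn a b ∪ openConn a c : Set (BondConfig V))
    (openConn a b : Set (BondConfig V))
  have h2 := ClusterCovTransfer.real_eq_inter_add_inter_compl w
    ((openConn a b ∪ openConn a c : Set (BondConfig V)) ∩ (openConn a b : Set (BondConfig V))) (openConn a c : Set (BondConfig V))
  have e1 : (openConn a b ∪ openConn a c : Set (BondConfig V)) ∩ (openConn a b : Set (BondConfig V)) ∩ (openConn a c : Set (BondConfig V))
      = (openConn a b ∩ openConn a c : Set (BondConfig V)) := by
    ext ω; simp only [mem_inter_iff, mem_union]; tauto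
  have e2 : (openConn a b ∪ openConn a c : Set (BondConfig V)) ∩ (openConn a b : Set (BondConfig V)) ∩ (openConn a c : Set (BondConfig V))ᶜ
      = (openConn a b ∩ (openConn a c)ᶜ : Set (BondConfig V)) := by
    ext ω; simp only [mem_inter_iff, mem_union, mem_compl_iff]; tauto
  have e3 : (openConn a b ∪ openConn a c : Set (BondConfig V)) ∩ (openConn a b : Set (BondConfig V))ᶜ
      = (openConn a c ∩ (openConn a b)ᶜ : Set (BondConfig V)) := by
    ext ω; simp only [mem_inter_iff, mem_union, mem_compl_iff]; tauto
  rw [e1, e2] at h2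
  rw [e3] at h1
  linarith

/-- **APL(2/3) FOR EVERY FINITE WEIGHTED GRAPH, event form**:
`2·μ(b ↮ c)·μ(a ↔ b ∨ a ↔ c) ≤ 3·(μ(a↔b, a↮c) + μ(a↔c, a↮b))`, i.e. `P({a ↔ {b,c}} ∩ {b ↮ c}) ≥ (2/3)·P(a ↔ {b,c})·P(b ↮ c)`.
[this work] -/
theorem apl_twoThirds_all (w : Sym2 V → unitInterval) (a b c : V) :
    2 * (prodBernoulli w).real ((openConn b c : Set (BondConfig V))ᶜ) *
        (prodBernoulli w).real (openConn a b ∪ openConn a c : Set (BondConfig V)) ≤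
      3 * ((prodBernoulli w).real (openConn a b ∩ (openConn a c)ᶜ : Set (BondConfig V))
        + (prodBernoulli w).real (openConn a c ∩ (openConn a b)ᶜ : Set (BondConfig V))) := by
  rw [real_notConn_bc_eq_cells w a b c, real_conn_ab_or_ac_eq_cells w a b c, mul_assoc]
  exact apl23_all w a b c

end APL

end Summit.CriticalPhenomena.PercolationContinuityZ3.Theorems

end
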